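import Summits.Ventures.PercRepro.ProfilePointedCircuitClassesTwelveSparse

/-!
# PercRepro — THE GIRTH REGIME OF `InOutBottomFive`: `in_5(e) ≤ out_6(e)` ON EVERY MATROID OF NULLITY `5` WHOSE
`(ρ − 1)`-SUBSETS ARE ALL INDEPENDENT (p5, gen 43; `proofs/P5-GM1.md` §65(k))

`InOutBottomFive` (ProfilePointedCircuitClassesSixTop) asks `in_5(e) ≤ out_6(e)` on every matroid with
`#E = ρ + 5`, `ρ ≥ 7`.  In the PRIMAL, a DEMAND is a bi-independent `5`-set `W ∋ e` (its complement `B` a basis, `ρ`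
points), a UNIT a bi-independent `6`-set `S ∌ e`, and the disjointness relation `W ∩ S = ∅` is counted from both
sides: a unit has at most `C(ρ − 2, 4)` demands disjoint from it (`W − e` is a `4`-subset of the `ρ − 2` points of
`(E ∖ S) − e`; `card_demands_disjoint_le_choose`), and when every `(ρ − 1)`-subset of `E` is independent — circuits
have at least `ρ` elements — a demand has `C(ρ, ρ − 6)` units disjoint from it, one for each `(ρ − 6)`-subset `Y` of
`B` (`S := B ∖ Y`, whose complement `W ∪ Y` has `ρ − 1` points; `choose_le_card_units_of_girth`).  As
`C(ρ − 2, 4) ≤ C(ρ, 6)` (Pascal twice), `C(ρ, 6)·#𝒟 ≤ Σ_W s(W) = Σ_S p(S) ≤ C(ρ − 2, 4)·#𝒰` gives `#𝒟 ≤ #𝒰`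
(`inCount_five_le_outCount_six_of_girth`).  At `ρ = 7` the hypothesis (every `6`-subset independent) is stronger than
the sparse regime's (every `8`-subset of rank `≥ 6`, TwelveSparse); for `ρ ≥ 8` it is the first unconditional regime
of `InOutBottomFive` beyond the coloop / loop / twin reductions of InOutFive.
-/

open scoped Matroid

namespace PercRepro.Cogirth

open Finset ThmH Skew Shadow Profile

variable {α : Type} [DecidableEq α] {N : Matroid α} [N.Finite]

section InOutFiveGirth

/-- **THE UNITS' SIDE**: on `#E = ρ + 5`, a bi-independent `6`-set `S ∌ e` has at most `C(ρ − 2, 4)` bi-independent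
`5`-sets `W ∋ e` disjoint from it (`W ↦ W − e` is injective into the `4`-subsets of `(E ∖ S) − e`). -/
theorem card_demands_disjoint_le_choose (hn : (gr N).card = rk N (gr N) + 5) {e : α} {S : Finset α}
    (hS : S ∈ (biIndepSets N 6).filter (fun X => e ∉ X)) :
    (((biIndepSets N 5).filter (fun X => e ∈ X)).filter (fun W => W ∩ S = ∅)).card ≤
      (rk N (gr N) - 2).choose 4 := by
  rw [mem_filter, mem_biIndepSets] at hS
  obtain ⟨⟨hSg, hS6, _, _⟩, heS⟩ := hS
  have hZ : (gr N \ S).card = rk N (gr N) - 1 := by rw [card_sdiff_of_subset hSg, hS6]; omega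
  -- a demand disjoint from `S` lies inside `E ∖ S`
  have hWZ : ∀ W ∈ ((biIndepSets N 5).filter (fun X => e ∈ X)).filter (fun W => W ∩ S = ∅),
      W ⊆ gr N \ S := by
    intro W hW
    rw [mem_filter, mem_filter, mem_biIndepSets] at hW
    obtain ⟨⟨⟨hWg, _, _, _⟩, _⟩, hWS⟩ := hW
    intro w hw
    rw [mem_sdiff]
    refine ⟨hWg hw, fun hwS => ?_⟩
    have : w ∈ W ∩ S := mem_inter.2 ⟨hw, hwS⟩
    rw [hWS] at this
    exact notMem_empty w this
  by_cases he : e ∈ gr N \ S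
  · calc _ ≤ (((gr N \ S).erase e).powersetCard 4).card := by
          apply card_le_card_of_injOn (fun W => W.erase e)
          · intro W hW
            rw [mem_coe] at hW
            have hWZ' := hWZ W hW
            rw [mem_filter, mem_filter, mem_biIndepSets] at hW
            obtain ⟨⟨⟨_, hW5, _, _⟩, heW⟩, _⟩ := hW
            rw [mem_coe, mem_powersetCard]
            refine ⟨fun x hx => ?_, by rw [card_erase_of_mem heW, hW5]⟩
            rw [mem_erase] at hx ⊢
            exact ⟨hx.1, hWZ' hx.2⟩
          · intro W₁ hW₁ W₂ hW₂ h
            rw [mem_coe, mem_filter, mem_filter] at hW₁ hW₂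
            have h1 : W₁ = insert e (W₁.erase e) := (insert_erase hW₁.1.2).symm
            have h2 : W₂ = insert e (W₂.erase e) := (insert_erase hW₂.1.2).symm
            rw [h1, h2]
            simp only at h
            rw [h]
      _ = (rk N (gr N) - 2).choose 4 := by
          rw [card_powersetCard, card_erase_of_mem he, hZ]
          congr 1
  · -- no demand at all: `e ∈ W ⊆ E ∖ S` would put `e` in `E ∖ S`
    have : ((biIndepSets N 5).filter (fun X => e ∈ X)).filter (fun W => W ∩ S = ∅) = ∅ := by
      rw [eq_empty_iff_forall_notMem]
      intro W hW
      have hWZ' := hWZ W hW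
      rw [mem_filter, mem_filter] at hW
      exact he (hWZ' hW.1.2)
    rw [this, card_empty]
    exact Nat.zero_le _

/-- The unit `B ∖ Y` of a demand `W` and a `(ρ − 6)`-subset `Y` of its basis complement `B`, when `W ∪ Y` is
independent: a bi-independent `6`-set avoiding `e` and disjoint from `W`. -/
theorem sdiff_mem_units_of_indep (hn : (gr N).card = rk N (gr N) + 5) (hR : 7 ≤ rk N (gr N)) {e : α}
    {W : Finset α} (hW : W ∈ (biIndepSets N 5).filter (fun X => e ∈ X)) {Y : Finset α}
    (hY : Y ∈ (gr N \ W).powersetCard (rk N (gr N) - 6)) (hind : rk N (W ∪ Y) = (W ∪ Y).card) :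
    (gr N \ W) \ Y ∈ ((biIndepSets N 6).filter (fun X => e ∉ X)).filter (fun S => W ∩ S = ∅) := by
  rw [mem_filter, mem_biIndepSets] at hW
  obtain ⟨⟨hWg, hW5, _, hWc⟩, heW⟩ := hW
  rw [mem_powersetCard] at hY
  obtain ⟨hYB, hYc⟩ := hY
  have hB : (gr N \ W).card = rk N (gr N) := by rw [card_sdiff_of_subset hWg, hn, hW5]; omega
  have hcompl : gr N \ ((gr N \ W) \ Y) = W ∪ Y := by
    ext x
    simp only [mem_sdiff, mem_union, not_and, not_not]
    constructor
    · rintro ⟨hxg, h⟩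
      by_cases hxW : x ∈ W
      · exact Or.inl hxW
      · exact Or.inr (h ⟨hxg, hxW⟩)
    · rintro (hxW | hxY)
      · exact ⟨hWg hxW, fun h => absurd hxW h.2⟩
      · exact ⟨(mem_sdiff.1 (hYB hxY)).1, fun _ => hxY⟩
  rw [mem_filter, mem_filter, mem_biIndepSets]
  refine ⟨⟨⟨sdiff_subset.trans sdiff_subset, ?_, ?_, ?_⟩, ?_⟩, ?_⟩
  · rw [card_sdiff_of_subset hYB, hB, hYc]; omega
  · exact rk_eq_card_of_subset_of_rk_eq_card sdiff_subset (by rw [hWc])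
  · rw [hcompl, hind]
  · intro he
    exact (mem_sdiff.1 (mem_sdiff.1 he).1).2 heW
  · ext x
    simp only [mem_inter, mem_sdiff, notMem_empty, iff_false, not_and, not_not]
    intro hxW hxB
    exact absurd hxW hxB.2

/-- **THE DEMANDS' SIDE IN THE GIRTH REGIME**: when every `(ρ − 1)`-subset of `E` is independent, a bi-independent
`5`-set `W ∋ e` has at least `C(ρ, ρ − 6)` bi-independent `6`-sets avoiding `e` and disjoint from it. -/
theorem choose_le_card_units_of_girth (hn : (gr N).card = rk N (gr N) + 5) (hR : 7 ≤ rk N (gr N))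
    (hg : ∀ X ⊆ gr N, X.card = rk N (gr N) - 1 → rk N X = X.card) {e : α} {W : Finset α}
    (hW : W ∈ (biIndepSets N 5).filter (fun X => e ∈ X)) :
    (rk N (gr N)).choose (rk N (gr N) - 6) ≤
      (((biIndepSets N 6).filter (fun X => e ∉ X)).filter (fun S => W ∩ S = ∅)).card := by
  have hW' := hW
  rw [mem_filter, mem_biIndepSets] at hW'
  obtain ⟨⟨hWg, hW5, _, _⟩, _⟩ := hW'
  have hB : (gr N \ W).card = rk N (gr N) := by rw [card_sdiff_of_subset hWg, hn, hW5]; omega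
  calc (rk N (gr N)).choose (rk N (gr N) - 6)
      = ((gr N \ W).powersetCard (rk N (gr N) - 6)).card := by rw [card_powersetCard, hB]
    _ = (((gr N \ W).powersetCard (rk N (gr N) - 6)).image (fun Y => (gr N \ W) \ Y)).card := by
        rw [card_image_of_injOn]
        intro Y hY Y' hY' h
        rw [mem_coe, mem_powersetCard] at hY hY'
        have h' : (gr N \ W) \ Y = (gr N \ W) \ Y' := h
        have e1 := Finset.sdiff_sdiff_eq_self hY.1
        have e2 := Finset.sdiff_sdiff_eq_self hY'.1
        rw [← e1, ← e2, h']
    _ ≤ _ := by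
        apply card_le_card
        intro S hS
        rw [mem_image] at hS
        obtain ⟨Y, hY, rfl⟩ := hS
        have hind : rk N (W ∪ Y) = (W ∪ Y).card := by
          rw [mem_powersetCard] at hY
          apply hg
          · exact union_subset hWg (hY.1.trans sdiff_subset)
          · rw [card_union_of_disjoint, hW5, hY.2]
            · omega
            · rw [disjoint_left]
              intro x hxW hxY
              exact (mem_sdiff.1 (hY.1 hxY)).2 hxW
        exact sdiff_mem_units_of_indep hn hR hW hY hind

/-- `C(ρ − 2, 4) ≤ C(ρ, 6)` for `ρ ≥ 2` (Pascal's rule twice). -/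
theorem choose_sub_two_four_le_choose_six {ρ : ℕ} (hρ : 2 ≤ ρ) : (ρ - 2).choose 4 ≤ ρ.choose 6 := by
  obtain ⟨m, rfl⟩ : ∃ m, ρ = m + 2 := ⟨ρ - 2, by omega⟩
  rw [Nat.add_sub_cancel, show m + 2 = (m + 1) + 1 from rfl, Nat.choose_succ_succ, Nat.choose_succ_succ]
  omega

/-- **THE GIRTH REGIME OF `InOutBottomFive`**: on every matroid with `#E = ρ + 5`, `ρ ≥ 7`, in which every
`(ρ − 1)`-subset of the ground set is independent, `in_5(e) ≤ out_6(e)` at every point `e`. -/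
theorem inCount_five_le_outCount_six_of_girth (hn : (gr N).card = rk N (gr N) + 5) (hR : 7 ≤ rk N (gr N))
    (hg : ∀ X ⊆ gr N, X.card = rk N (gr N) - 1 → rk N X = X.card) (e : α) :
    inCount N 5 e ≤ outCount N 6 e := by
  unfold inCount outCount
  set D := (biIndepSets N 5).filter (fun X => e ∈ X) with hD
  set U := (biIndepSets N 6).filter (fun X => e ∉ X) with hU
  have key := Finset.sum_card_bipartiteAbove_eq_sum_card_bipartiteBelow (fun W S => W ∩ S = ∅)
    (s := D) (t := U)
  have h1 : (rk N (gr N)).choose (rk N (gr N) - 6) * D.card ≤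
      ∑ W ∈ D, (Finset.bipartiteAbove (fun W S => W ∩ S = ∅) U W).card := by
    rw [mul_comm, ← smul_eq_mul]
    apply card_nsmul_le_sum
    intro W hW
    unfold Finset.bipartiteAbove
    exact choose_le_card_units_of_girth hn hR hg hW
  have h2 : ∑ S ∈ U, (Finset.bipartiteBelow (fun W S => W ∩ S = ∅) D S).card ≤
      (rk N (gr N) - 2).choose 4 * U.card := by
    rw [mul_comm, ← smul_eq_mul]
    apply sum_le_card_nsmul
    intro S hS
    unfold Finset.bipartiteBelow
    exact card_demands_disjoint_le_choose hn hS
  -- `C(ρ, ρ − 6) = C(ρ, 6) ≥ C(ρ − 2, 4) > 0`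
  have hsym : (rk N (gr N)).choose (rk N (gr N) - 6) = (rk N (gr N)).choose 6 := by
    rw [Nat.choose_symm (by omega)]
  have hle := choose_sub_two_four_le_choose_six (ρ := rk N (gr N)) (by omega)
  have hpos : 0 < (rk N (gr N) - 2).choose 4 := Nat.choose_pos (by omega)
  rw [hsym] at h1
  -- `C(ρ, 6)·#D ≤ C(ρ − 2, 4)·#U ≤ C(ρ, 6)·#U`
  have h3 : (rk N (gr N)).choose 6 * D.card ≤ (rk N (gr N)).choose 6 * U.card := by
    calc (rk N (gr N)).choose 6 * D.card ≤ (rk N (gr N) - 2).choose 4 * U.card := by omega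
      _ ≤ (rk N (gr N)).choose 6 * U.card := Nat.mul_le_mul_right _ hle
  exact Nat.le_of_mul_le_mul_left h3 (by omega)

end InOutFiveGirth

end PercRepro.Cogirth
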